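import Mathlib.Analysis.SpecialFunctions.Trigonometric.Deriv
import Mathlib.Analysis.InnerProductSpace.Calculus
import Mathlib.Analysis.InnerProductSpace.PiL2
import Mathlib.Analysis.Calculus.Deriv.MeanValue
import Literature.Analysis.FluidPDE.TypeIAncientMild
import Literature.Analysis.FluidPDE.IsometryInvariance
import Literature.Analysis.FluidPDE.AxisymmetricHeatFlow
import Literature.Analysis.FluidPDE.KNSSTypeIRateLiouvilleHolds
import Summits.NavierStokesRegularity.NavierStokesRegularity.Theorems.SqueezeCycleExtremalElementExistsRescale
import Mathlib.Analysis.InnerProductSpace.Projection.Reflection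
import Summits.NavierStokesRegularity.NavierStokesRegularity.Theorems.SymmetricLiouville.Negative.SmallConstantGap
import Summits.NavierStokesRegularity.NavierStokesRegularity.Theses.SymmetryModuliCount
import Summits.NavierStokesRegularity.NavierStokesRegularity.Theorems.SqueezeCycleExtremalElementExistsExtraction

/-!
# Candidate proof (evidence, NOT a landing) of the ROUTE ITEM `HelicalEndLiouville`
# (stmt-NavierStokesRegularity-14062, route `SymmetryModuliCount`) — via the picked line
# `blowdown-kills-pitch` of crux `SymmetricLiouville` (stmt-NavierStokesRegularity-4053)

Assembled by the standing disprover of crux 4053 (refuter-cdisprove-…-4053-g3, 2026-08-16): the four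
OWN stubs of the lead's skeleton `Cruxes/SymmetricLiouville/Lines/blowdown-kills-pitch.lean`
(skeleton `415f7ae75d4c`) are proved sorry-free in this seat's folder —
`stub_screwIsPeriodic_proof` (StubScrewIsPeriodicProof.lean), `stub_rotationCovariance_proof`
(StubRotationCovarianceProof.lean), `stub_periodicBlowdownVanishing_proof`
(StubPeriodicBlowdownProof.lean), `stub_smallAtMinusInfinityLiouville_proof`
(StubSmallAtMinusInfinityProof.lean) — F3 (`stub_classCompactness`) is the tree's
`Theorems.exists_tendsto_of_isTypeIAncientMild_seq`, and the skeleton's sorry-free compositions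
`periodicLeaf_of` / `HelicalEndLiouville_of` (copied verbatim below) then give `HelicalEndLiouville`
BY NAME (`helicalEndLiouville_candidate`). This single file concatenates the four proof files + the
composition so that a PROVER can check it in one go (lean check: rc 0, 0 sorry) and land it split
into ≤ 400-line modules under `Theorems/`. Nothing here is a refutation; the crux 4053 itself is NOT
closed by this (its open core, stub 5b = bounded-profile rotated-self-similar Liouville, remains).
-/

noncomputable section

open Set Function Filter Topology MeasureTheory WithLp
open scoped RealInnerProductSpace
open Literature.Analysis Literature.Analysis.FluidPDE
open Summit.NavierStokesRegularity.NavierStokesRegularity.Theorems (isTypeIAncientMild_zoom zoom_apply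
  exists_tendsto_of_isTypeIAncientMild_seq)
open Summit.NavierStokesRegularity.NavierStokesRegularity.Theorems.SymmetricLiouville
open Summit.NavierStokesRegularity.NavierStokesRegularity.Theses.SymmetryModuliCount (HelicalEndLiouville)

namespace Summit.NavierStokesRegularity.NavierStokesRegularity.Theorems.SymmetryModuliCountSymmetricLiouville

/-- Local notation for physical space `ℝ³`. -/
local notation "E3" => EuclideanSpace ℝ (Fin 3)

/-! ## From `StubScrewIsPeriodicProof.lean` -/



/-! ### The cross product on `E3` in coordinates -/

/-- `ω × x`. -/
def crossE (ω x : E3) : E3 :=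
  toLp 2 ![ω 1 * x 2 - ω 2 * x 1, ω 2 * x 0 - ω 0 * x 2, ω 0 * x 1 - ω 1 * x 0]

@[simp] theorem crossE_apply_zero (ω x : E3) : crossE ω x 0 = ω 1 * x 2 - ω 2 * x 1 := rfl
@[simp] theorem crossE_apply_one (ω x : E3) : crossE ω x 1 = ω 2 * x 0 - ω 0 * x 2 := rfl
@[simp] theorem crossE_apply_two (ω x : E3) : crossE ω x 2 = ω 0 * x 1 - ω 1 * x 0 := rfl

/-- `|ω|²` in coordinates. -/
def sqn (ω : E3) : ℝ := ω 0 ^ 2 + ω 1 ^ 2 + ω 2 ^ 2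

/-- `ω · a` in coordinates. -/
def dotE (ω a : E3) : ℝ := ω 0 * a 0 + ω 1 * a 1 + ω 2 * a 2

/-- The standard basis vectors. -/
def bv (i : Fin 3) : E3 := EuclideanSpace.single i (1 : ℝ)

theorem sqn_nonneg (ω : E3) : 0 ≤ sqn ω := by unfold sqn; positivity

theorem sqn_eq_zero_iff (ω : E3) : sqn ω = 0 ↔ ω = 0 := by
  constructor
  · intro h
    unfold sqn at h
    have h0 : ω 0 = 0 := by nlinarith [sq_nonneg (ω 0), sq_nonneg (ω 1), sq_nonneg (ω 2)]
    have h1 : ω 1 = 0 := by nlinarith [sq_nonneg (ω 0), sq_nonneg (ω 1), sq_nonneg (ω 2)]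
    have h2 : ω 2 = 0 := by nlinarith [sq_nonneg (ω 0), sq_nonneg (ω 1), sq_nonneg (ω 2)]
    ext i
    fin_cases i <;> simp [h0, h1, h2]
  · rintro rfl
    simp [sqn]

theorem crossE_zero_left (x : E3) : crossE 0 x = 0 := by
  ext i; fin_cases i <;> simp [crossE]

theorem crossE_self (ω : E3) : crossE ω ω = 0 := by
  ext i; fin_cases i <;> simp [crossE] <;> ring

theorem crossE_smul (ω : E3) (c : ℝ) (x : E3) : crossE ω (c • x) = c • crossE ω x := by
  ext i; fin_cases i <;> simp [crossE] <;> ring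

/-- BAC–CAB: `ω × (ω × x) = (ω·x) ω − |ω|² x`. -/
theorem crossE_crossE (ω x : E3) : crossE ω (crossE ω x) = dotE ω x • ω - sqn ω • x := by
  ext i; fin_cases i <;> simp [crossE, dotE, sqn] <;> ring

/-- `A³ = −ρ²A` for `A = ω × ·`. -/
theorem crossE_triple (ω x : E3) : crossE ω (crossE ω (crossE ω x)) = -sqn ω • crossE ω x := by
  ext i; fin_cases i <;> simp [crossE, sqn] <;> ring

theorem dotE_self (ω : E3) : dotE ω ω = sqn ω := by
  simp only [dotE, sqn]; ring

theorem dotE_sub (ω a b : E3) : dotE ω (a - b) = dotE ω a - dotE ω b := by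
  simp only [dotE, PiLp.sub_apply]; ring

theorem dotE_smul (ω : E3) (c : ℝ) (a : E3) : dotE ω (c • a) = c * dotE ω a := by
  simp only [dotE, PiLp.smul_apply, smul_eq_mul]; ring

/-! ### Normal form of a skew operator on `ℝ³` -/

/-- Coordinates are inner products with the basis. -/
theorem apply_eq_inner_bv (v : E3) (i : Fin 3) : v i = ⟪v, bv i⟫ := by
  simp [bv, EuclideanSpace.inner_single_right]

/-- **Every skew operator on `ℝ³` is a cross product**: `⟪Ax, x⟫ = 0` for all `x` implies
`A x = ω × x` with `ω = (A₂₁, A₀₂, A₁₀)`. -/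
theorem exists_crossE_of_skew (A : E3 →L[ℝ] E3) (hA : ∀ x, ⟪A x, x⟫ = 0) :
    ∃ ω : E3, ∀ x, A x = crossE ω x := by
  have hpol : ∀ x y : E3, ⟪A x, y⟫ = -⟪A y, x⟫ := by
    intro x y
    have h := hA (x + y)
    rw [map_add, inner_add_left, inner_add_right, inner_add_right, hA x, hA y] at h
    linarith
  have d0 : (A (bv 0)) 0 = 0 := by rw [apply_eq_inner_bv]; exact hA (bv 0)
  have d1 : (A (bv 1)) 1 = 0 := by rw [apply_eq_inner_bv]; exact hA (bv 1)
  have d2 : (A (bv 2)) 2 = 0 := by rw [apply_eq_inner_bv]; exact hA (bv 2)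
  have s01 : (A (bv 1)) 0 = -(A (bv 0)) 1 := by
    rw [apply_eq_inner_bv, apply_eq_inner_bv, hpol]
  have s12 : (A (bv 2)) 1 = -(A (bv 1)) 2 := by
    rw [apply_eq_inner_bv, apply_eq_inner_bv, hpol]
  have s20 : (A (bv 0)) 2 = -(A (bv 2)) 0 := by
    rw [apply_eq_inner_bv, apply_eq_inner_bv, hpol]
  refine ⟨toLp 2 ![(A (bv 1)) 2, (A (bv 2)) 0, (A (bv 0)) 1], fun x => ?_⟩
  have hx : x = x 0 • bv 0 + x 1 • bv 1 + x 2 • bv 2 := by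
    ext i
    fin_cases i <;> simp [bv]
  conv_lhs => rw [hx]
  simp only [map_add, map_smul]
  ext i
  fin_cases i <;> simp [crossE, d0, d1, d2, s01, s12, s20] <;> ring

/-! ### The Rodrigues exponential of a skew operator -/

/-- `E(s) y = y + (sin ρs/ρ) A y + ((1 − cos ρs)/ρ²) A² y`. -/
def expA (A : E3 →L[ℝ] E3) (ρ s : ℝ) (y : E3) : E3 :=
  y + (Real.sin (ρ * s) / ρ) • A y + ((1 - Real.cos (ρ * s)) / ρ ^ 2) • A (A y)

theorem expA_zero (A : E3 →L[ℝ] E3) (ρ : ℝ) (y : E3) : expA A ρ 0 y = y := by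
  simp [expA]

theorem expA_period (A : E3 →L[ℝ] E3) {ρ : ℝ} (hρ : ρ ≠ 0) (y : E3) :
    expA A ρ (2 * Real.pi / ρ) y = y := by
  have e : ρ * (2 * Real.pi / ρ) = 2 * Real.pi := by field_simp
  simp only [expA]
  rw [e, Real.sin_two_pi, Real.cos_two_pi]
  simp

/-- `A E(s) y = cos ρs · A y + (sin ρs/ρ) A² y` when `A³ = −ρ² A`. -/
theorem map_expA (A : E3 →L[ℝ] E3) {ρ : ℝ} (hρ : ρ ≠ 0) (hA3 : ∀ y, A (A (A y)) = -(ρ ^ 2) • A y)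
    (s : ℝ) (y : E3) :
    A (expA A ρ s y) = Real.cos (ρ * s) • A y + (Real.sin (ρ * s) / ρ) • A (A y) := by
  have hc : (1 - Real.cos (ρ * s)) / ρ ^ 2 * -(ρ ^ 2) = -(1 - Real.cos (ρ * s)) := by
    field_simp
  simp only [expA, map_add, map_smul, hA3, smul_smul, hc]
  module

/-- `d/ds E(s) y = A E(s) y`. -/
theorem hasDerivAt_expA (A : E3 →L[ℝ] E3) {ρ : ℝ} (hρ : ρ ≠ 0)
    (hA3 : ∀ y, A (A (A y)) = -(ρ ^ 2) • A y) (y : E3) (s : ℝ) :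
    HasDerivAt (fun σ => expA A ρ σ y) (A (expA A ρ s y)) s := by
  have hlin : HasDerivAt (fun σ : ℝ => ρ * σ) ρ s := by
    simpa using (hasDerivAt_id s).const_mul ρ
  have h1 : HasDerivAt (fun σ => Real.sin (ρ * σ) / ρ) (Real.cos (ρ * s)) s := by
    refine (((Real.hasDerivAt_sin (ρ * s)).comp s hlin).div_const ρ).congr_deriv ?_
    field_simp
  have h2 : HasDerivAt (fun σ => (1 - Real.cos (ρ * σ)) / ρ ^ 2) (Real.sin (ρ * s) / ρ) s := by
    refine ((((Real.hasDerivAt_cos (ρ * s)).comp s hlin).const_sub 1).div_const (ρ ^ 2)).congr_deriv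
      ?_
    rw [div_eq_div_iff (pow_ne_zero 2 hρ) hρ]
    ring
  have h := ((h1.smul_const (A y)).const_add y).add (h2.smul_const (A (A y)))
  rw [map_expA A hρ hA3]
  exact h

/-! ### The stub -/

/-- **Stub 1 of the skeleton, verbatim signature** (`Sig.stub_screwIsPeriodic` unfolded):
screw ⊃ lattice. -/
theorem stub_screwIsPeriodic_proof :
    ∀ (a : E3) (A : E3 →L[ℝ] E3), (∀ x, ⟪A x, x⟫ = 0) → a ∉ Set.range A →
      ∃ e : E3, e ≠ 0 ∧ ∀ v : E3 → E3, Differentiable ℝ v →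
        (∀ x, fderiv ℝ v x (a + A x) = A (v x)) → ∀ x, v (x + e) = v x := by
  intro a A hA hra
  obtain ⟨ω, hω⟩ := exists_crossE_of_skew A hA
  by_cases hω0 : sqn ω = 0
  · -- `ω = 0`, `A = 0`: the clause is `a·∇v = 0`, the period is `a`
    have hωz : ω = 0 := (sqn_eq_zero_iff ω).1 hω0
    have hAz : ∀ x, A x = 0 := fun x => by rw [hω, hωz, crossE_zero_left]
    have ha : a ≠ 0 := fun h => hra ⟨0, by rw [hAz, h]⟩
    refine ⟨a, ha, fun v hv hcl x => ?_⟩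
    have hd : ∀ t : ℝ, HasDerivAt (fun s : ℝ => v (x + s • a)) 0 t := by
      intro t
      have h1 : HasDerivAt (fun s : ℝ => x + s • a) a t := by
        simpa using ((hasDerivAt_id t).smul_const a).const_add x
      have h2 := (hv (x + t • a)).hasFDerivAt.comp_hasDerivAt t h1
      have e : fderiv ℝ v (x + t • a) a = 0 := by
        have := hcl (x + t • a)
        rwa [hAz, hAz, add_zero] at this
      rwa [e] at h2
    have hconst := is_const_of_deriv_eq_zero (fun s => (hd s).differentiableAt)
      (fun s => (hd s).deriv) 1 0
    simpa using hconst
  · -- `ω ≠ 0`: the screw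
    have hρ2 : 0 < sqn ω := lt_of_le_of_ne (sqn_nonneg ω) (Ne.symm hω0)
    set ρ : ℝ := Real.sqrt (sqn ω) with hρdef
    have hρ : 0 < ρ := Real.sqrt_pos.2 hρ2
    have hρsq : ρ ^ 2 = sqn ω := Real.sq_sqrt hρ2.le
    have hA3 : ∀ y, A (A (A y)) = -(ρ ^ 2) • A y := by
      intro y
      simp only [hω]
      rw [hρsq]
      exact crossE_triple ω y
    -- decomposition of `a` along `ω`
    set κ : ℝ := dotE ω a / sqn ω with hκdef
    set apar : E3 := κ • ω with hapar
    set aperp : E3 := a - apar with haperp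
    have hdot : dotE ω a ≠ 0 := by
      intro h0
      apply hra
      refine ⟨(-(sqn ω)⁻¹) • crossE ω a, ?_⟩
      rw [hω, crossE_smul, crossE_crossE, h0, zero_smul, zero_sub, smul_neg, neg_smul, neg_neg,
        inv_smul_smul₀ hω0]
    have hκ : κ ≠ 0 := div_ne_zero hdot hω0
    have hωne : ω ≠ 0 := fun h => hω0 ((sqn_eq_zero_iff ω).2 h)
    have hapar_ne : apar ≠ 0 := smul_ne_zero hκ hωne
    have hAapar : A apar = 0 := by rw [hω, hapar, crossE_smul, crossE_self, smul_zero]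
    have hdot_perp : dotE ω aperp = 0 := by
      rw [haperp, dotE_sub, hapar, dotE_smul, dotE_self, hκdef, div_mul_cancel₀ _ hω0, sub_self]
    set c0 : E3 := (sqn ω)⁻¹ • crossE ω aperp with hc0
    have hAc0 : A c0 = -aperp := by
      rw [hω, hc0, crossE_smul, crossE_crossE, hdot_perp, zero_smul, zero_sub, smul_neg,
        inv_smul_smul₀ hω0]
    -- the period vector
    refine ⟨(2 * Real.pi / ρ) • apar, smul_ne_zero (div_ne_zero (by positivity) hρ.ne') hapar_ne,
      fun v hv hcl x => ?_⟩
    -- the orbit of the Killing field `a + A·` through `x`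
    set γ : ℝ → E3 := fun s => c0 + expA A ρ s (x - c0) + s • apar with hγ
    have hγd : ∀ s, HasDerivAt γ (a + A (γ s)) s := by
      intro s
      have h1 := hasDerivAt_expA A hρ.ne' hA3 (x - c0) s
      have h2 : HasDerivAt (fun σ : ℝ => σ • apar) apar s := by
        simpa using (hasDerivAt_id s).smul_const apar
      have h := (h1.const_add c0).add h2
      refine h.congr_deriv ?_
      rw [hγ]
      simp only [map_add, map_smul, hAc0, hAapar, smul_zero, add_zero]
      rw [haperp]
      abel
    -- `w = v ∘ γ − E(·) v(x)` solves `w' = A w`, `w 0 = 0`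
    set w : ℝ → E3 := fun s => v (γ s) - expA A ρ s (v x) with hw
    have hwd : ∀ s, HasDerivAt w (A (w s)) s := by
      intro s
      have hu1 : HasDerivAt (fun σ => v (γ σ)) (fderiv ℝ v (γ s) (a + A (γ s))) s :=
        (hv (γ s)).hasFDerivAt.comp_hasDerivAt s (hγd s)
      rw [hcl (γ s)] at hu1
      have hu2 := hasDerivAt_expA A hρ.ne' hA3 (v x) s
      have h3 := hu1.sub hu2
      rwa [← map_sub] at h3
    have hn : ∀ s, HasDerivAt (fun σ => ⟪w σ, w σ⟫) 0 s := by
      intro s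
      have h1 := (hwd s).inner ℝ (hwd s)
      have e : ⟪w s, A (w s)⟫ + ⟪A (w s), w s⟫ = 0 := by
        rw [real_inner_comm, hA, add_zero]
      rwa [e] at h1
    have hconst : ∀ s, ⟪w s, w s⟫ = ⟪w 0, w 0⟫ := fun s =>
      is_const_of_deriv_eq_zero (fun σ => (hn σ).differentiableAt) (fun σ => (hn σ).deriv) s 0
    have hw0 : w 0 = 0 := by
      simp [hw, hγ, expA_zero]
    have hwT : w (2 * Real.pi / ρ) = 0 := by
      have h1 := hconst (2 * Real.pi / ρ)
      rw [hw0, inner_zero_left, real_inner_self_eq_norm_sq] at h1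
      have : ‖w (2 * Real.pi / ρ)‖ = 0 := by nlinarith [norm_nonneg (w (2 * Real.pi / ρ))]
      exact norm_eq_zero.1 this
    have key : v (γ (2 * Real.pi / ρ)) - expA A ρ (2 * Real.pi / ρ) (v x) = 0 := hwT
    rw [expA_period A hρ.ne', sub_eq_zero, hγ] at key
    simp only [expA_period A hρ.ne'] at key
    have e : c0 + (x - c0) + (2 * Real.pi / ρ) • apar = x + (2 * Real.pi / ρ) • apar := by abel
    rw [e] at key
    exact key


/-! ## From `StubRotationCovarianceProof.lean` -/



/-- **The closed-form Oseen kernel is equivariant under every linear isometry** (rotations AND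
reflections): `K(τ, Lz)[La, Lb] = L (K(τ, z)[a, b])`. -/
theorem oseenKernel_map_linearIsometryEquiv (L : E3 ≃ₗᵢ[ℝ] E3) (τ : ℝ) (z a b : E3) :
    oseenKernel τ (L z) (L a) (L b) = L (oseenKernel τ z a b) := by
  have hG : ∀ s : ℝ, UnboundedOperators.heatKernel s (L z) = UnboundedOperators.heatKernel s z :=
    fun s => by
    rw [UnboundedOperators.heatKernel_eq, UnboundedOperators.heatKernel_eq, L.norm_map]
  have hA : oseenWeightA τ (L z) = oseenWeightA τ z := by
    simp only [oseenWeightA, hG]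
  have hB : oseenWeightB τ (L z) = oseenWeightB τ z := by
    simp only [oseenWeightB, hG]
  simp only [oseenKernel, LinearIsometryEquiv.inner_map_map, hG, hA, hB, map_add, map_sub,
    LinearIsometryEquiv.map_smul]

/-- **The heat flow is conjugation-covariant**: `e^{τΔ}(L ∘ φ ∘ L⁻¹)(x) = L (e^{τΔ}φ)(L⁻¹x)`, for
every `τ` (for `τ ≤ 0` both sides are the junk/identity branch). -/
theorem heatFlow_conj_linearIsometryEquiv (L : E3 ≃ₗᵢ[ℝ] E3) (φ : E3 → E3) (τ : ℝ) (x : E3) :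
    heatFlow (fun y => L (φ (L.symm y))) τ x = L (heatFlow φ τ (L.symm x)) := by
  rcases le_or_gt τ 0 with hτ | hτ
  · rw [heatFlow_of_nonpos _ hτ, heatFlow_of_nonpos _ hτ]
  · rw [heatFlow_of_pos _ hτ, heatFlow_of_pos _ hτ]
    have h1 := heatExtension_continuousLinearEquiv_comp L.toContinuousLinearEquiv
      (fun y => φ (L.symm y)) τ x
    simp only [LinearIsometryEquiv.coe_toContinuousLinearEquiv] at h1
    rw [h1, heatExtension_comp_linearIsometryEquiv L.symm φ τ x]

/-- A linear isometry commutes with the Bochner integral (no integrability hypothesis). -/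
theorem integral_linearIsometryEquiv_comm (L : E3 ≃ₗᵢ[ℝ] E3) {X : Type*} [MeasurableSpace X]
    (μ : Measure X) (φ : X → E3) : ∫ x, L (φ x) ∂μ = L (∫ x, φ x ∂μ) :=
  L.toLinearIsometry.integral_comp_comm φ

/-- **The Oseen–Duhamel term is conjugation-covariant**:
`B^ν_s(L u L⁻¹, L v L⁻¹)(t, x) = L B^ν_s(u, v)(t, L⁻¹x)` (change of variables `y ↦ L y`, kernel
equivariance, and `L` commutes with both Bochner integrals — no integrability needed). -/
theorem oseenDuhamel_conj_linearIsometryEquiv (L : E3 ≃ₗᵢ[ℝ] E3) (ν s : ℝ) (u v : ℝ → E3 → E3)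
    (t : ℝ) (x : E3) :
    oseenDuhamel ν s (fun τ y => L (u τ (L.symm y))) (fun τ y => L (v τ (L.symm y))) t x =
      L (oseenDuhamel ν s u v t (L.symm x)) := by
  simp only [oseenDuhamel_apply]
  rw [← integral_linearIsometryEquiv_comm]
  refine setIntegral_congr_fun measurableSet_Ioo fun τ _ => ?_
  rw [← integral_linearIsometryEquiv_comm]
  rw [← L.measurePreserving.integral_comp L.toHomeomorph.measurableEmbedding
    (fun y => oseenKernel (ν * (t - τ)) (x - y) (L (u τ (L.symm y))) (L (v τ (L.symm y))))]
  refine integral_congr_ae (Eventually.of_forall fun y => ?_)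
  have e : x - L y = L (L.symm x - y) := by
    rw [map_sub, LinearIsometryEquiv.apply_symm_apply]
  simp only [LinearIsometryEquiv.symm_apply_apply]
  rw [e, oseenKernel_map_linearIsometryEquiv]

/-- **`A_C` is invariant under conjugation by linear isometries** (same constant):
`u ∈ A_C ⇒ (t, x) ↦ L u(t, L⁻¹x) ∈ A_C`. -/
theorem isTypeIAncientMild_conj_linearIsometryEquiv {C : ℝ} {u : ℝ → E3 → E3}
    (h : IsTypeIAncientMild C u) (L : E3 ≃ₗᵢ[ℝ] E3) :
    IsTypeIAncientMild C (fun t x => L (u t (L.symm x))) := by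
  refine ⟨?_, fun t ht => (h.isDivFree ht).conj_linearIsometryEquiv L, fun s t hst ht x => ?_,
    fun t ht x => ?_⟩
  · have e : (uncurry fun t x => L (u t (L.symm x))) =
        (fun v => L.toContinuousLinearEquiv v) ∘ uncurry u ∘
          fun p : ℝ × E3 => (p.1, L.symm.toContinuousLinearEquiv p.2) := by
      funext p
      rfl
    rw [e]
    refine L.toContinuousLinearEquiv.contDiff.comp_contDiffOn (h.contDiffOn.comp
      ((contDiff_fst.prodMk (L.symm.toContinuousLinearEquiv.contDiff.comp contDiff_snd)).contDiffOn)
      ?_)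
    intro p hp
    exact mem_prod.2 ⟨(mem_prod.1 hp).1, mem_univ _⟩
  · show L (u t (L.symm x)) = heatFlow (fun y => L (u s (L.symm y))) (t - s) x -
        oseenDuhamel 1 s (fun τ y => L (u τ (L.symm y))) (fun τ y => L (u τ (L.symm y))) t x
    rw [heatFlow_conj_linearIsometryEquiv, oseenDuhamel_conj_linearIsometryEquiv, ← map_sub,
      ← h.mild_eq hst ht (L.symm x)]
  · show ‖L (u t (L.symm x))‖ ≤ C / Real.sqrt (-t)
    rw [L.norm_map]
    exact h.norm_le ht _

/-- **Stub 2' of the skeleton, verbatim signature** (`Sig.stub_rotationCovariance` unfolded). -/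
theorem stub_rotationCovariance_proof :
    ∀ (C : ℝ) (L : E3 ≃ₗᵢ[ℝ] E3) (u : ℝ → E3 → E3), IsTypeIAncientMild C u →
      IsTypeIAncientMild C (fun t x => L (u t (L.symm x))) :=
  fun _ L _ h => isTypeIAncientMild_conj_linearIsometryEquiv h L


/-! ## From `StubPeriodicBlowdownProof.lean` -/



/-- A field with period `e` has every natural multiple of `e` as a period. -/
theorem periodic_nat {f : E3 → E3} {e : E3} (h : ∀ x, f (x + e) = f x) :
    ∀ (n : ℕ) (x : E3), f (x + (n : ℝ) • e) = f x
  | 0, x => by simp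
  | n + 1, x => by
    have e1 : x + ((n : ℝ) + 1) • e = (x + (n : ℝ) • e) + e := by rw [add_smul, one_smul, add_assoc]
    rw [Nat.cast_succ, e1, h, periodic_nat h n x]

/-- **Stub 3 of the skeleton (the lever), verbatim signature**: blow-down kills the pitch. -/
theorem stub_periodicBlowdownVanishing_proof :
    ∀ C : ℝ,
      (∀ v : ℕ → ℝ → E3 → E3, (∀ n, IsTypeIAncientMild C (v n)) →
      ∃ (φ : ℕ → ℕ) (w : ℝ → E3 → E3), StrictMono φ ∧ IsTypeIAncientMild C w ∧
        ∀ t < 0, TendstoLocallyUniformly (fun n => v (φ n) t) (w t) atTop) →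
      (∀ (L : E3 ≃ₗᵢ[ℝ] E3) (u : ℝ → E3 → E3), IsTypeIAncientMild C u →
      IsTypeIAncientMild C (fun t x => L (u t (L.symm x)))) →
      ∀ u : ℝ → E3 → E3, IsTypeIAncientMild C u →
        ∀ e : E3, e ≠ 0 → (∀ t < 0, ∀ x, u t (x + e) = u t x) →
        ∀ ε > 0, ∃ T < 0, ∀ t < T, ∀ x, Real.sqrt (-t) * ‖u t x‖ ≤ ε := by
  intro C hF3 hrot u hu e he hper ε hε
  by_contra hcon
  push Not at hcon
  -- violating sequence `t_n < -(n+1)`, `x_n`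
  have hseq : ∀ n : ℕ, ∃ t : ℝ, t < -((n : ℝ) + 1) ∧ ∃ x : E3, ε < Real.sqrt (-t) * ‖u t x‖ :=
    fun n => hcon (-((n : ℝ) + 1)) (by have := n.cast_nonneg (α := ℝ); linarith)
  choose tn htn xn hxn using hseq
  have htn0 : ∀ n, tn n < 0 := fun n => by
    have h1 := htn n
    have h2 := n.cast_nonneg (α := ℝ)
    linarith
  -- scales `c_n = √(−t_n) → ∞`
  obtain ⟨c, hc⟩ : ∃ c : ℕ → ℝ, ∀ n, c n = Real.sqrt (-tn n) := ⟨_, fun n => rfl⟩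
  have hcpos : ∀ n, 0 < c n := fun n => by rw [hc]; exact Real.sqrt_pos.2 (by linarith [htn0 n])
  have hcsq : ∀ n, c n ^ 2 = -tn n := fun n => by rw [hc]; exact Real.sq_sqrt (by linarith [htn0 n])
  have hc_tendsto : Tendsto c atTop atTop := by
    refine tendsto_atTop.2 fun b => ?_
    refine (eventually_ge_atTop (⌈b ^ 2⌉₊)).mono fun n hn => ?_
    have hn' : b ^ 2 ≤ (n : ℝ) := (Nat.le_ceil _).trans (by exact_mod_cast hn)
    have h1 : b ^ 2 ≤ -tn n := by have := htn n; linarith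
    calc b ≤ |b| := le_abs_self b
      _ = Real.sqrt (b ^ 2) := (Real.sqrt_sq_eq_abs b).symm
      _ ≤ Real.sqrt (-tn n) := Real.sqrt_le_sqrt h1
      _ = c n := (hc n).symm
  -- blow-downs `v_n (s, y) = c_n u(c_n² s, x_n + c_n y)` in `A_C`
  obtain ⟨v, hv⟩ : ∃ v : ℕ → ℝ → E3 → E3, ∀ n, v n = c n • stPull (c n ^ 2) (c n) 0 (xn n) u :=
    ⟨_, fun n => rfl⟩
  have hvcl : ∀ n, IsTypeIAncientMild C (v n) := fun n => by
    rw [hv]; exact isTypeIAncientMild_zoom hu (hcpos n) (xn n)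
  have hv_apply : ∀ n s y, v n s y = c n • u (c n ^ 2 * s) (xn n + c n • y) := fun n s y => by
    rw [hv n]; exact zoom_apply _ _ _ _ _
  have hv0 : ∀ n, ε < ‖v n (-1) 0‖ := by
    intro n
    have e1 : c n ^ 2 * -1 = tn n := by rw [hcsq]; ring
    rw [hv_apply, smul_zero, add_zero, e1, norm_smul, Real.norm_of_nonneg (hcpos n).le, hc]
    exact hxn n
  -- natural multiples of `e/c_n` are periods of `v_n`
  have hvper : ∀ n, ∀ s < 0, ∀ (k : ℕ) (y : E3), v n s (y + ((k : ℝ) * (c n)⁻¹) • e) = v n s y := by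
    intro n s hs k y
    have hcs : c n ^ 2 * s < 0 := mul_neg_of_pos_of_neg (pow_pos (hcpos n) 2) hs
    have e1 : c n * ((k : ℝ) * (c n)⁻¹) = k := by
      rw [mul_comm, mul_assoc, inv_mul_cancel₀ (hcpos n).ne', mul_one]
    rw [hv_apply, hv_apply, smul_add, smul_smul, e1, ← add_assoc]
    congr 1
    exact periodic_nat (hper _ hcs) k _
  -- F3: extract a limit `W ∈ A_C`
  obtain ⟨φ, W, hφ, hW, hloc⟩ := hF3 v hvcl
  have hW0 : ε ≤ ‖W (-1) 0‖ := by
    have h1 : Tendsto (fun j => v (φ j) (-1) 0) atTop (𝓝 (W (-1) 0)) :=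
      (hloc (-1) (by norm_num)).tendsto_comp (hW.continuous_slice (by norm_num)).continuousAt
        tendsto_const_nhds
    exact ge_of_tendsto' h1.norm fun j => (hv0 (φ j)).le
  -- the limit is invariant under the whole line `ℝ e`
  have hcφ : Tendsto (fun j => c (φ j)) atTop atTop := hc_tendsto.comp hφ.tendsto_atTop
  have hline_pos : ∀ t < 0, ∀ (y : E3) (s : ℝ), 0 ≤ s → W t (y + s • e) = W t y := by
    intro t ht y s hs
    have hg : Tendsto (fun j => (⌊s * c (φ j)⌋₊ : ℝ) * (c (φ j))⁻¹) atTop (𝓝 s) := by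
      have hinv : Tendsto (fun j => (c (φ j))⁻¹) atTop (𝓝 0) := tendsto_inv_atTop_zero.comp hcφ
      have hlow : Tendsto (fun j => s - (c (φ j))⁻¹) atTop (𝓝 s) := by
        simpa using tendsto_const_nhds.sub hinv
      refine tendsto_of_tendsto_of_tendsto_of_le_of_le hlow tendsto_const_nhds (fun j => ?_)
        (fun j => ?_)
      · have hcj := hcpos (φ j)
        have h1 : s * c (φ j) < (⌊s * c (φ j)⌋₊ : ℝ) + 1 := Nat.lt_floor_add_one _
        have h2 : s - (c (φ j))⁻¹ = (s * c (φ j) - 1) * (c (φ j))⁻¹ := by field_simp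
        show s - (c (φ j))⁻¹ ≤ (⌊s * c (φ j)⌋₊ : ℝ) * (c (φ j))⁻¹
        rw [h2]
        exact mul_le_mul_of_nonneg_right (by linarith) (inv_nonneg.2 hcj.le)
      · have hcj := hcpos (φ j)
        have h1 : (⌊s * c (φ j)⌋₊ : ℝ) ≤ s * c (φ j) := Nat.floor_le (by positivity)
        show (⌊s * c (φ j)⌋₊ : ℝ) * (c (φ j))⁻¹ ≤ s
        calc (⌊s * c (φ j)⌋₊ : ℝ) * (c (φ j))⁻¹ ≤ (s * c (φ j)) * (c (φ j))⁻¹ :=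
              mul_le_mul_of_nonneg_right h1 (inv_nonneg.2 hcj.le)
          _ = s := by field_simp
    have hgE : Tendsto (fun j => y + ((⌊s * c (φ j)⌋₊ : ℝ) * (c (φ j))⁻¹) • e) atTop
        (𝓝 (y + s • e)) :=
      tendsto_const_nhds.add (hg.smul_const e)
    have h1 : Tendsto (fun j => v (φ j) t (y + ((⌊s * c (φ j)⌋₊ : ℝ) * (c (φ j))⁻¹) • e)) atTop
        (𝓝 (W t (y + s • e))) :=
      (hloc t ht).tendsto_comp (hW.continuous_slice ht).continuousAt hgE
    have h2 : Tendsto (fun j => v (φ j) t y) atTop (𝓝 (W t y)) :=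
      (hloc t ht).tendsto_comp (hW.continuous_slice ht).continuousAt tendsto_const_nhds
    have h3 : (fun j => v (φ j) t (y + ((⌊s * c (φ j)⌋₊ : ℝ) * (c (φ j))⁻¹) • e)) =
        fun j => v (φ j) t y := by
      funext j
      exact hvper (φ j) t ht _ y
    rw [h3] at h1
    exact tendsto_nhds_unique h1 h2
  have hline : ∀ t < 0, ∀ (y : E3) (s : ℝ), W t (y + s • e) = W t y := by
    intro t ht y s
    rcases le_or_gt 0 s with hs | hs
    · exact hline_pos t ht y s hs
    · have h1 := hline_pos t ht (y + s • e) (-s) (by linarith)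
      rw [add_assoc, ← add_smul, add_neg_cancel, zero_smul, add_zero] at h1
      exact h1.symm
  -- rotate `e/|e|` onto the `x₂`-axis and shift time by `1/2`
  obtain ⟨e1, he1⟩ : ∃ e1 : E3, e1 = ‖e‖⁻¹ • e := ⟨_, rfl⟩
  obtain ⟨f2, hf2⟩ : ∃ f2 : E3, f2 = EuclideanSpace.single 1 (1 : ℝ) := ⟨_, rfl⟩
  have hne1 : ‖e1‖ = ‖f2‖ := by
    rw [he1, hf2, norm_smul, norm_inv, norm_norm, inv_mul_cancel₀ (norm_ne_zero_iff.2 he)]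
    simp
  obtain ⟨L, hL⟩ : ∃ L : E3 ≃ₗᵢ[ℝ] E3, L = (ℝ ∙ (e1 - f2))ᗮ.reflection := ⟨_, rfl⟩
  have hLe1 : L e1 = f2 := by rw [hL]; exact Submodule.reflection_sub hne1
  have hLsymm : L.symm f2 = e1 := by rw [← hLe1, LinearIsometryEquiv.symm_apply_apply]
  obtain ⟨W1, hW1def⟩ : ∃ W1 : ℝ → E3 → E3, W1 = fun t x => L (W t (L.symm x)) := ⟨_, rfl⟩
  have hW1 : IsTypeIAncientMild C W1 := by rw [hW1def]; exact hrot L W hW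
  obtain ⟨W2, hW2def⟩ : ∃ W2 : ℝ → E3 → E3, W2 = fun t => W1 (t - 1 / 2) := ⟨_, rfl⟩
  have hW2 : IsTypeIAncientMild C W2 := by rw [hW2def]; exact hW1.comp_sub_right (by norm_num)
  have hW2_apply : ∀ t x, W2 t x = L (W (t - 1 / 2) (L.symm x)) := fun t x => by
    rw [hW2def, hW1def]
  have hW2_norm : ∀ t < 0, ∀ x, ‖W2 t x‖ ≤ C / Real.sqrt (-(t - 1 / 2)) := fun t ht x => by
    rw [hW2def]
    exact hW1.norm_le (by linarith) x
  -- the hypotheses of the KNSS 2.5-D Liouville theorem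
  have hK1 : ContinuousOn (uncurry W2) (Iio 0 ×ˢ univ) := hW2.continuousOn_uncurry
  have hK2 : ∃ K : ℝ, ∀ t < 0, ∀ x, ‖W2 t x‖ ≤ K := by
    refine ⟨C / Real.sqrt (1 / 2), fun t ht x => (hW2_norm t ht x).trans ?_⟩
    exact div_le_div_of_nonneg_left hW2.nonneg (Real.sqrt_pos.2 (by norm_num))
      (Real.sqrt_le_sqrt (by linarith))
  have hK3 : ∀ t < 0, IsWeaklyDivFree (W2 t) := fun t ht => hW2.isWeaklyDivFree ht
  have hK4 : ∀ s t : ℝ, s < t → t < 0 → ∀ x, W2 t x =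
      UnboundedOperators.heatExtension (W2 s) (t - s) x - oseenDuhamel 1 s W2 W2 t x :=
    fun s t hst ht x => hW2.mild_eq_heatExtension hst ht x
  have hK5 : ∀ t < 0, ∀ (x : E3) (δ : ℝ), W2 t (x + EuclideanSpace.single 1 δ) = W2 t x := by
    intro t ht x δ
    have e2 : EuclideanSpace.single (1 : Fin 3) δ = δ • f2 := by
      rw [hf2]
      ext i
      fin_cases i <;> simp
    rw [hW2_apply, hW2_apply, map_add, e2, LinearIsometryEquiv.map_smul, hLsymm, he1, smul_smul]
    congr 1
    exact hline (t - 1 / 2) (by linarith) (L.symm x) _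
  have hK6 : ∀ t < 0, ∀ x, Real.sqrt (-t) * ‖W2 t x‖ ≤ C := by
    intro t ht x
    have h1 := hW2_norm t ht x
    have hs : Real.sqrt (-t) ≤ Real.sqrt (-(t - 1 / 2)) := Real.sqrt_le_sqrt (by linarith)
    have hpos : 0 < Real.sqrt (-(t - 1 / 2)) := Real.sqrt_pos.2 (by linarith)
    calc Real.sqrt (-t) * ‖W2 t x‖ ≤ Real.sqrt (-(t - 1 / 2)) * (C / Real.sqrt (-(t - 1 / 2))) :=
          mul_le_mul hs h1 (norm_nonneg _) (Real.sqrt_nonneg _)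
      _ = C := by rw [← mul_div_assoc, mul_div_cancel_left₀ _ hpos.ne']
  have hzero : ∀ t < 0, ∀ x, W2 t x = 0 := KNSS2009_typeI_rate_liouville_holds hK1 hK2 hK3 hK4 hK5 hK6
  -- conclude: `W(−1, 0) = 0`, contradicting `‖W(−1, 0)‖ ≥ ε`
  have h1 : W2 (-1 / 2) 0 = 0 := hzero (-1 / 2) (by norm_num) 0
  rw [hW2_apply, map_zero, show (-1 / 2 - 1 / 2 : ℝ) = -1 by norm_num] at h1
  have h3 : W (-1) 0 = 0 := by simpa using h1
  rw [h3, norm_zero] at hW0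
  linarith


/-! ## From `StubSmallAtMinusInfinityProof.lean` -/



/-- **One step**: if `u ∈ A_C` vanishes on `(−∞, t₁)` with `t₁ < 0`, then it vanishes on
`(−∞, t₁ + η)` for `η = ½ ε₀²(−t₁)/(C² + ε₀²)`, where `ε₀` is the gap constant. -/
theorem vanishes_beyond {ε₀ : ℝ} (hε₀ : 0 < ε₀)
    (hgap : ∀ (C : ℝ) (u : ℝ → E3 → E3), Negative.InClass C u →
      (∀ t < 0, ∀ x, Real.sqrt (-t) * ‖u t x‖ ≤ ε₀) → Negative.VanishesOnPast u)
    {C : ℝ} {u : ℝ → E3 → E3} (hcl : IsTypeIAncientMild C u) {t₁ : ℝ} (ht₁ : t₁ < 0)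
    (hvan : ∀ t < t₁, ∀ x, u t x = 0) :
    ∀ t < t₁ + ε₀ ^ 2 * (-t₁) / (C ^ 2 + ε₀ ^ 2) / 2, ∀ x, u t x = 0 := by
  have hC : 0 ≤ C := hcl.nonneg
  set η : ℝ := ε₀ ^ 2 * (-t₁) / (C ^ 2 + ε₀ ^ 2) / 2 with hη
  have hden : 0 < C ^ 2 + ε₀ ^ 2 := by positivity
  have hη0 : 0 < η := by
    rw [hη]
    apply half_pos
    exact div_pos (mul_pos (pow_pos hε₀ 2) (neg_pos.2 ht₁)) hden
  -- `η (C² + ε₀²) ≤ ½ ε₀² (−t₁)`, hence `η < −t₁` and the window inequality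
  have hηle : η * (C ^ 2 + ε₀ ^ 2) = ε₀ ^ 2 * (-t₁) / 2 := by
    rw [hη]
    field_simp
  have hηlt : η < -t₁ := by
    have h1 : η * (C ^ 2 + ε₀ ^ 2) ≤ ε₀ ^ 2 * (-t₁) / 2 := hηle.le
    have h2 : η * ε₀ ^ 2 ≤ η * (C ^ 2 + ε₀ ^ 2) :=
      mul_le_mul_of_nonneg_left (by nlinarith) hη0.le
    have h3 : 0 < ε₀ ^ 2 * (-t₁) := mul_pos (pow_pos hε₀ 2) (neg_pos.2 ht₁)
    nlinarith [pow_pos hε₀ 2]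
  -- the past-shift by `δ = −(t₁ + η) > 0`
  set δ : ℝ := -(t₁ + η) with hδ
  have hδ0 : 0 ≤ δ := by rw [hδ]; linarith
  have hv : IsTypeIAncientMild C (fun s => u (s - δ)) := hcl.comp_sub_right hδ0
  have hvI : Negative.InClass C (fun s => u (s - δ)) := isTypeIAncientMild_iff.1 hv
  -- smallness of the shifted field on the whole past
  have hsmall : ∀ s < 0, ∀ x, Real.sqrt (-s) * ‖u (s - δ) x‖ ≤ ε₀ := by
    intro s hs x
    by_cases hsw : s - δ < t₁
    · rw [hvan _ hsw x, norm_zero, mul_zero]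
      exact hε₀.le
    · -- the window `s − δ ≥ t₁`, i.e. `−s ≤ η`
      push Not at hsw
      have hs' : -s ≤ η := by rw [hδ] at hsw; linarith
      have hpos : 0 < -(s - δ) := by rw [hδ]; linarith
      have hb : ‖u (s - δ) x‖ ≤ C / Real.sqrt (-(s - δ)) := hcl.norm_le (by linarith) x
      have hsq : 0 < Real.sqrt (-(s - δ)) := Real.sqrt_pos.2 hpos
      -- square comparison: `(−s) C² ≤ ε₀² (−(s − δ))`
      have key : (-s) * C ^ 2 ≤ ε₀ ^ 2 * (-(s - δ)) := by
        have h1 : (-s) * C ^ 2 ≤ η * C ^ 2 := mul_le_mul_of_nonneg_right hs' (sq_nonneg C)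
        have h2 : ε₀ ^ 2 * (-t₁ - η) ≤ ε₀ ^ 2 * (-(s - δ)) := by
          apply mul_le_mul_of_nonneg_left _ (sq_nonneg ε₀)
          rw [hδ]; linarith
        have h3 : η * C ^ 2 ≤ ε₀ ^ 2 * (-t₁ - η) := by nlinarith [hηle]
        linarith
      have key' : Real.sqrt (-s) * C ≤ ε₀ * Real.sqrt (-(s - δ)) := by
        have h1 : Real.sqrt ((-s) * C ^ 2) ≤ Real.sqrt (ε₀ ^ 2 * (-(s - δ))) :=
          Real.sqrt_le_sqrt key
        rwa [Real.sqrt_mul (neg_pos.2 hs).le, Real.sqrt_sq hC, Real.sqrt_mul (sq_nonneg ε₀),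
          Real.sqrt_sq hε₀.le] at h1
      calc Real.sqrt (-s) * ‖u (s - δ) x‖ ≤ Real.sqrt (-s) * (C / Real.sqrt (-(s - δ))) :=
            mul_le_mul_of_nonneg_left hb (Real.sqrt_nonneg _)
        _ = Real.sqrt (-s) * C / Real.sqrt (-(s - δ)) := by ring
        _ ≤ ε₀ * Real.sqrt (-(s - δ)) / Real.sqrt (-(s - δ)) :=
            div_le_div_of_nonneg_right key' hsq.le
        _ = ε₀ := by field_simp
  have hzero := hgap C _ hvI hsmall
  intro t ht x
  have ht' : t + δ < 0 := by rw [hδ]; rw [hη] at ht ⊢; linarith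
  have := hzero (t + δ) ht' x
  simpa only [add_sub_cancel_right] using this

/-- **Stub 4 of the skeleton, verbatim signature** (`Sig.stub_smallAtMinusInfinityLiouville`
unfolded): an element of `A_C` with `√(−t)‖u(t)‖_∞ → 0` as `t → −∞` vanishes identically. -/
theorem stub_smallAtMinusInfinityLiouville_proof :
    ∀ (C : ℝ) (u : ℝ → E3 → E3), IsTypeIAncientMild C u →
      (∀ ε > 0, ∃ T < 0, ∀ t < T, ∀ x, Real.sqrt (-t) * ‖u t x‖ ≤ ε) →
      ∀ t < 0, ∀ x, u t x = 0 := by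
  intro C u hcl hsmall
  obtain ⟨ε₀, hε₀, hgap⟩ := Negative.exists_eps_small_vanishes
  obtain ⟨T, hT, hTs⟩ := hsmall ε₀ hε₀
  -- Step 1: `u = 0` on `(−∞, T)` — the gap theorem on the past-shift `s ↦ u(s + T)`
  have hvan0 : ∀ t < T, ∀ x, u t x = 0 := by
    have hv : IsTypeIAncientMild C (fun s => u (s - -T)) := hcl.comp_sub_right (by linarith)
    have hvI : Negative.InClass C (fun s => u (s - -T)) := isTypeIAncientMild_iff.1 hv
    have hsm : ∀ s < 0, ∀ x, Real.sqrt (-s) * ‖u (s - -T) x‖ ≤ ε₀ := by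
      intro s hs x
      have h1 := hTs (s - -T) (by linarith) x
      have h2 : Real.sqrt (-s) ≤ Real.sqrt (-(s - -T)) := Real.sqrt_le_sqrt (by linarith)
      exact (mul_le_mul_of_nonneg_right h2 (norm_nonneg _)).trans h1
    have hz := hgap C _ hvI hsm
    intro t ht x
    have := hz (t + -T) (by linarith) x
    simpa only [add_sub_cancel_right] using this
  -- Step 2: the set of bad times is empty (least bad time + one step of `vanishes_beyond`)
  by_contra hbad
  push Not at hbad
  obtain ⟨t₀, ht₀, x₀, hx₀⟩ := hbad
  set B : Set ℝ := {t | t < 0 ∧ ∃ x, u t x ≠ 0} with hB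
  have hBne : B.Nonempty := ⟨t₀, ht₀, x₀, hx₀⟩
  have hBbdd : BddBelow B := ⟨T, fun b hb => by
    by_contra hlt
    push Not at hlt
    obtain ⟨x, hx⟩ := hb.2
    exact hx (hvan0 b hlt x)⟩
  set t₁ : ℝ := sInf B with ht₁def
  have ht₁le : ∀ b ∈ B, t₁ ≤ b := fun b hb => csInf_le hBbdd hb
  have ht₁neg : t₁ < 0 := (ht₁le t₀ ⟨ht₀, x₀, hx₀⟩).trans_lt ht₀
  have hvan1 : ∀ t < t₁, ∀ x, u t x = 0 := by
    intro t ht x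
    by_contra hx
    have htneg : t < 0 := ht.trans ht₁neg
    exact absurd (ht₁le t ⟨htneg, x, hx⟩) (not_le.2 ht)
  have hstep := vanishes_beyond hε₀ hgap hcl ht₁neg hvan1
  have hηpos : 0 < ε₀ ^ 2 * (-t₁) / (C ^ 2 + ε₀ ^ 2) / 2 := by
    have hC : 0 ≤ C := hcl.nonneg
    apply half_pos
    exact div_pos (mul_pos (pow_pos hε₀ 2) (neg_pos.2 ht₁neg)) (by positivity)
  obtain ⟨b, hb, hblt⟩ := exists_lt_of_csInf_lt hBne
    (show sInf B < t₁ + ε₀ ^ 2 * (-t₁) / (C ^ 2 + ε₀ ^ 2) / 2 by rw [← ht₁def]; linarith)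
  obtain ⟨x, hx⟩ := hb.2
  exact hx (hstep b hblt x)


/-! ## F3 and the compositions (from the lead's skeleton, sorry-free) -/

/-- **F3** (`stub_classCompactness`), from the tree. -/
theorem stub_classCompactness_proof :
    ∀ C : ℝ, (∀ v : ℕ → ℝ → E3 → E3, (∀ n, IsTypeIAncientMild C (v n)) →
      ∃ (φ : ℕ → ℕ) (w : ℝ → E3 → E3), StrictMono φ ∧ IsTypeIAncientMild C w ∧
        ∀ t < 0, TendstoLocallyUniformly (fun n => v (φ n) t) (w t) atTop) := by
  intro C v hv
  obtain ⟨φ, hφ, W, hW, -, -, hloc, -⟩ := exists_tendsto_of_isTypeIAncientMild_seq C hv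
  exact ⟨φ, W, hφ, hW, hloc⟩

/-- **The periodic leaf of the crux on the whole past** (skeleton's `periodicLeaf_of`, instantiated). -/
theorem periodicLeaf_candidate :
    ∀ (C : ℝ) (u : ℝ → E3 → E3), IsTypeIAncientMild C u →
      ∀ (a : E3) (A : E3 →L[ℝ] E3), (∀ x, ⟪A x, x⟫ = 0) → a ∉ Set.range A →
        (∀ t < 0, ∀ x, fderiv ℝ (u t) x (a + A x) - A (u t x) = 0) → ∀ t < 0, ∀ x, u t x = 0 := by
  intro C u hcl a A hA hra hK
  obtain ⟨e, he, hper⟩ := stub_screwIsPeriodic_proof a A hA hra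
  have hperu : ∀ t < 0, ∀ x, u t (x + e) = u t x := by
    intro t ht x
    refine hper (u t) ((hcl.contDiff_slice ht).differentiable (by simp)) (fun y => ?_) x
    exact sub_eq_zero.1 (hK t ht y)
  exact stub_smallAtMinusInfinityLiouville_proof C u hcl
    (stub_periodicBlowdownVanishing_proof C (stub_classCompactness_proof C)
      (stub_rotationCovariance_proof C) u hcl e he hperu)

/-- **Route item `HelicalEndLiouville` (stmt-NavierStokesRegularity-14062) BY NAME** — candidate
proof (skeleton's `HelicalEndLiouville_of`, instantiated with the proved stubs; end-to-past reduction
by `IsTypeIAncientMild.comp_sub_right`). -/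
theorem helicalEndLiouville_candidate : HelicalEndLiouville := by
  intro C u hcl a A θ hA hra hθ hsym t ht x
  have hv : IsTypeIAncientMild C (fun s => u (s - -θ)) := hcl.comp_sub_right (by linarith)
  have hsv : ∀ s < 0, ∀ y,
      fderiv ℝ ((fun s => u (s - -θ)) s) y (a + A y) - A ((fun s => u (s - -θ)) s y) = 0 := by
    intro s hs y
    exact hsym (s - -θ) (by linarith) y
  have key := periodicLeaf_candidate C (fun s => u (s - -θ)) hv a A hA hra hsv (t - θ)
    (by linarith) x
  have e : t - θ - -θ = t := by ring
  simpa only [e] using key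

end Summit.NavierStokesRegularity.NavierStokesRegularity.Theorems.SymmetryModuliCountSymmetricLiouville

end
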